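import Summits.AtomisticToContinuum.BoseEinsteinCondensation.Theses.BECDipoleTransport
import Literature.MathematicalPhysics.QuantumManyBody.PeriodicBoseGasFracEnergy

/-!
# Route BECDipoleTransport, support item `WindowModeCounting` (stmt-AtomisticToContinuum-14625)

Closes `…Theses.BECDipoleTransport.WindowModeCounting`: for each repulsive finite-range `v`,
GaussianWindow(v) → [MesoscopicTail body for v] → [PeriodicBEC body for v, `c = 1/2`].
Here GaussianWindow(v) says that for some `K > 0` and every `ε > 0`, at all small densities the
periodic near-minimisers `Ψ` of `n+1` bosons on the torus of side `L = ((n+1)/ρ)^{1/3}` admit a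
radius `R` with `K ≤ R√ρ ≤ 2K` and `∑_{k ≠ 0} e^{-R²p_k²/2} n_Ψ(k) ≤ ε(n+1)` (`p_k = 2πk/L`,
`n_Ψ(k)` the occupation of the plane wave `L^{-3/2}e^{2πik·x/L}`); the MesoscopicTail body says
that the shells `cube(M) ∖ cube(m)` with `m + 1 ≥ K₀L√ρ/2π` carry at most `εN` particles.

Proof (the item's sketch, a Parseval count):
* choose `K₀ = 1`, `m = ⌊L√ρ/2π⌋` (so `K₀L√ρ/2π ≤ m+1` and `2πm/L ≤ √ρ`); on `cube(m) ∖ {0}` the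
  Gaussian weight is at least `e^{-A}`, `A = 6K²` (`R²p_k²/2 ≤ ½·R²(2π/L)²·3m² ≤ (3/2)(R√ρ)² ≤ 6K²`),
  so the window bound with `ε_W = e^{-A}/4` gives `∑_{cube(m)∖0} n_k ≤ N/4`;
* the tail bound with `ε = 1/4` bounds `∑_{ℤ³ ∖ cube(m)} n_k ≤ N/4` uniformly in the outer cutoff
  `M`, hence for the infinite sum (monotone convergence, `ENNReal.tsum_eq_iSup_sum'`);
* Parseval in the traced variable `∑_k n_k = N` (`PeriodicTrialState.tsum_cellOccupation_planeWaveMode`)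
  and `n_0 = condensateOccupation` (`cellOccupation_planeWaveMode_zero`), whence
  `n_0 ≥ N − N/4 − N/4 = N/2`;
* `ρ₀ = min`, `δ = min`, and the index shift `n+1 ↔ N` under `∀ᶠ`.

## References

* [LSSY2005] Lieb, Seiringer, Solovej, Yngvason, *The Mathematics of the Bose Gas and its
  Condensation* (2005), §1.2 (1.17)–(1.19) (one-particle density matrix, `tr γ = N`).
* [PenroseOnsager1956] O. Penrose, L. Onsager, Phys. Rev. 104 (1956) 576 (mode counting).
-/

noncomputable section

open MeasureTheory Filter
open scoped ENNReal NNReal BigOperators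

namespace Summit.AtomisticToContinuum.BoseEinsteinCondensation.Theorems

namespace WindowModeCounting

open Literature.MathematicalPhysics.QuantumManyBody.BoseGas

/-! ## §1 Lattice bookkeeping: the cubes `{-M,…,M}³` as order intervals of `ℤ³`

The cube `{-M, …, M}³ ⊂ ℤ³` is written throughout, as in the route items, as the order interval
`Finset.Icc (fun _ : Fin 3 => -(M : ℤ)) (fun _ : Fin 3 => (M : ℤ))` of the lattice `Fin 3 → ℤ`
(no notation and no new definition, so that the statements match the route decl verbatim). -/

/-- Membership in the cube `{-M,…,M}³` is `|k_j| ≤ M` for all `j`. [folklore] -/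
theorem mem_cube {M : ℕ} {k : Fin 3 → ℤ} :
    k ∈ Finset.Icc (fun _ : Fin 3 => -((M : ℕ) : ℤ)) (fun _ : Fin 3 => ((M : ℕ) : ℤ)) ↔
      ∀ j, |k j| ≤ M := by
  simp only [Finset.mem_Icc, Pi.le_def, abs_le]
  exact ⟨fun h j => ⟨h.1 j, h.2 j⟩, fun h => ⟨fun j => (h j).1, fun j => (h j).2⟩⟩

/-- Every finite set of lattice points lies in some cube `{-M,…,M}³`. [folklore] -/
theorem exists_subset_cube (t : Finset (Fin 3 → ℤ)) :
    ∃ M : ℕ, t ⊆ Finset.Icc (fun _ : Fin 3 => -((M : ℕ) : ℤ)) (fun _ : Fin 3 => ((M : ℕ) : ℤ)) := by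
  refine ⟨t.sup fun k => Finset.univ.sup fun j => (k j).natAbs,
    fun k hk => mem_cube.2 fun j => ?_⟩
  have h1 : (k j).natAbs ≤ Finset.univ.sup fun i => (k i).natAbs :=
    Finset.le_sup (f := fun i => (k i).natAbs) (Finset.mem_univ j)
  have h2 : (Finset.univ.sup fun i => (k i).natAbs) ≤
      t.sup fun k : Fin 3 → ℤ => Finset.univ.sup fun j => (k j).natAbs :=
    Finset.le_sup (f := fun k : Fin 3 → ℤ => Finset.univ.sup fun j => (k j).natAbs) hk
  rw [Int.abs_eq_natAbs]
  exact_mod_cast h1.trans h2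

/-- On the cube `{-m,…,m}³`, `∑_j k_j² ≤ 3m²`. [folklore] -/
theorem sum_sq_le_of_mem_cube {m : ℕ} {k : Fin 3 → ℤ}
    (hk : k ∈ Finset.Icc (fun _ : Fin 3 => -((m : ℕ) : ℤ)) (fun _ : Fin 3 => ((m : ℕ) : ℤ))) :
    ∑ l, ((k l : ℤ) : ℝ) ^ 2 ≤ 3 * (m : ℝ) ^ 2 := by
  have h : ∀ l, ((k l : ℤ) : ℝ) ^ 2 ≤ (m : ℝ) ^ 2 := fun l => by
    have h1 : |((k l : ℤ) : ℝ)| ≤ (m : ℝ) := by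
      rw [← Int.cast_abs]
      exact_mod_cast (mem_cube.1 hk l)
    exact sq_le_sq' (abs_le.1 h1).1 (abs_le.1 h1).2
  calc ∑ l, ((k l : ℤ) : ℝ) ^ 2 ≤ ∑ _l : Fin 3, (m : ℝ) ^ 2 := Finset.sum_le_sum fun l _ => h l
    _ = 3 * (m : ℝ) ^ 2 := by simp

/-- **Monotone convergence for the tail**: a bound on the sums over the shells
`{-M,…,M}³ ∖ {-m,…,m}³` uniform in the outer cutoff `M` bounds the sum over everything outside
`{-m,…,m}³` (the cubes exhaust `ℤ³`; `ENNReal.tsum_eq_iSup_sum'`). [folklore] -/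
theorem tsum_ite_mem_cube_le {m : ℕ} (n : (Fin 3 → ℤ) → ℝ≥0∞) {B : ℝ≥0∞}
    (h : ∀ M : ℕ, ∑ k ∈ Finset.Icc (fun _ : Fin 3 => -((M : ℕ) : ℤ)) (fun _ : Fin 3 => ((M : ℕ) : ℤ))
      \ Finset.Icc (fun _ : Fin 3 => -((m : ℕ) : ℤ)) (fun _ : Fin 3 => ((m : ℕ) : ℤ)), n k ≤ B) :
    (∑' k, if k ∈ Finset.Icc (fun _ : Fin 3 => -((m : ℕ) : ℤ)) (fun _ : Fin 3 => ((m : ℕ) : ℤ))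
      then 0 else n k) ≤ B := by
  rw [ENNReal.tsum_eq_iSup_sum' _ exists_subset_cube]
  refine iSup_le fun M => ?_
  have hM := h M
  rw [Finset.sdiff_eq_filter, Finset.sum_filter] at hM
  simpa only [ite_not] using hM

/-! ## §2 The counting step in abstract form -/

/-- **Mode counting on the torus with a window and a tail (abstract form).** Let `Ψ` be a periodic
`N`-body state on the torus of side `L`, `n_k` the occupations of the plane waves
`L^{-3/2} e^{2πik·x/L}`, `Q ⊂ ℤ³` finite and `w` a weight with `E·w_k ≥ 1` on `Q ∖ {0}`. If
(window) `∑_{k≠0} w_k n_k ≤ W`, (tail) `∑_{k ∉ Q} n_k ≤ T`, and (budget) `E·W + T ≤ N/2`, then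
`⟨Ψ, n₀Ψ⟩ ≥ N/2`: pointwise `n_k ≤ [k=0]n_k + E·[k≠0]w_k n_k + 1_{ℤ³∖Q}(k) n_k`, summed with
Parseval in the traced variable `∑_k n_k = N` (`tr γ_Ψ = N`), and `n_0 = ⟨Ψ, n₀Ψ⟩`.
[cite: LSSY2005, §1.2 (1.17)–(1.19)] -/
theorem condensate_ge_half {N : ℕ} {L : ℝ} (hL : 0 < L) (Ψ : PeriodicTrialState N L)
    (Q : Finset (Fin 3 → ℤ)) (w : (Fin 3 → ℤ) → ℝ≥0∞) {E W T : ℝ≥0∞}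
    (hfloor : ∀ k : Fin 3 → ℤ, k ≠ 0 → k ∈ Q → 1 ≤ E * w k)
    (hwin : (∑' k : Fin 3 → ℤ, if k ≠ 0 then w k *
      cellOccupation N L (fun x => ((Real.sqrt (L ^ 3))⁻¹ : ℂ) * cellWave L k x) Ψ.ψ else 0) ≤ W)
    (htail : (∑' k : Fin 3 → ℤ, if k ∈ Q then 0 else
      cellOccupation N L (fun x => ((Real.sqrt (L ^ 3))⁻¹ : ℂ) * cellWave L k x) Ψ.ψ) ≤ T)
    (hbudget : E * W + T ≤ ENNReal.ofReal (1 / 2 * N)) :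
    ENNReal.ofReal (1 / 2 * N) ≤ condensateOccupation N L Ψ.ψ := by
  classical
  set n : (Fin 3 → ℤ) → ℝ≥0∞ := fun k =>
    cellOccupation N L (fun x => ((Real.sqrt (L ^ 3))⁻¹ : ℂ) * cellWave L k x) Ψ.ψ with hn
  have hn' : n = fun k => cellOccupation N L (planeWaveMode L k) Ψ.ψ := by
    funext k
    simp only [hn]
    congr 1
    exact funext fun x => (planeWaveMode_eq L k x).symm
  -- pointwise three-way bound: zero mode / window / tail
  have hpt : ∀ k, n k ≤ (if k = 0 then n k else 0) + E * (if k ≠ 0 then w k * n k else 0) +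
      (if k ∈ Q then 0 else n k) := by
    intro k
    by_cases hk0 : k = 0
    · rw [if_pos hk0]
      exact le_add_right (le_add_right le_rfl)
    · rw [if_neg hk0, if_pos hk0, zero_add]
      by_cases hkQ : k ∈ Q
      · rw [if_pos hkQ, add_zero]
        calc n k = 1 * n k := (one_mul _).symm
          _ ≤ E * w k * n k := by gcongr; exact hfloor k hk0 hkQ
          _ = E * (w k * n k) := mul_assoc _ _ _
      · rw [if_neg hkQ]
        exact le_add_left le_rfl
  -- Parseval and summation of the pointwise bound
  have hsum : (N : ℝ≥0∞) ≤ n 0 + ENNReal.ofReal (1 / 2 * N) := by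
    calc (N : ℝ≥0∞) = ∑' k, n k := by
          rw [hn']
          exact (Ψ.tsum_cellOccupation_planeWaveMode hL).symm
      _ ≤ ∑' k, ((if k = 0 then n k else 0) + E * (if k ≠ 0 then w k * n k else 0) +
          (if k ∈ Q then 0 else n k)) := ENNReal.tsum_le_tsum hpt
      _ = n 0 + E * (∑' k, if k ≠ 0 then w k * n k else 0) + ∑' k, (if k ∈ Q then 0 else n k) := by
          rw [ENNReal.tsum_add, ENNReal.tsum_add, tsum_ite_eq 0 n, ENNReal.tsum_mul_left]
      _ ≤ n 0 + E * W + T := add_le_add (add_le_add le_rfl (mul_le_mul' le_rfl hwin)) htail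
      _ ≤ n 0 + ENNReal.ofReal (1 / 2 * N) := by rw [add_assoc]; gcongr
  -- conclusion: `N/2 + N/2 ≤ n₀ + N/2`
  have h2 : ENNReal.ofReal (1 / 2 * N) + ENNReal.ofReal (1 / 2 * N) = (N : ℝ≥0∞) := by
    rw [← ENNReal.ofReal_add (by positivity) (by positivity), ← ENNReal.ofReal_natCast]
    exact congrArg ENNReal.ofReal (by ring)
  have hhalf : ENNReal.ofReal (1 / 2 * N) + ENNReal.ofReal (1 / 2 * N) ≤
      n 0 + ENNReal.ofReal (1 / 2 * N) := by
    rw [h2]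
    exact hsum
  have h0 : n 0 = condensateOccupation N L Ψ.ψ := by
    rw [hn']
    exact cellOccupation_planeWaveMode_zero N L Ψ.ψ
  rw [← h0]
  exact ENNReal.le_of_add_le_add_right ENNReal.ofReal_ne_top hhalf

end WindowModeCounting

/-! ## §3 The route item -/

open Literature.MathematicalPhysics.QuantumManyBody.BoseGas
open Summit.AtomisticToContinuum.BoseEinsteinCondensation.Theses.BECDipoleTransport
open WindowModeCounting

/-- **Window mode counting** (route BECDipoleTransport, item `WindowModeCounting`,
stmt-AtomisticToContinuum-14625): for each repulsive finite-range `v`, the Gaussian-window bound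
(`∃ K > 0 ∀ ε ∃ ρ₀ …`: a radius `R ∈ [K/√ρ, 2K/√ρ]` with `∑_{k≠0} e^{-R²p_k²/2} n_Ψ(k) ≤ ε(n+1)`)
and the mesoscopic tail bound (`∑_{cube(M)∖cube(m)} n_Ψ ≤ εN` whenever `m+1 ≥ K₀L√ρ/2π`) for the
periodic near-minimisers imply condensation `⟨Ψ, n₀Ψ⟩ ≥ N/2` of the near-minimisers on the torus
of side `(N/ρ)^{1/3}` at all small densities, eventually in `N`. Constants: `K₀ = 1`,
`m = ⌊L√ρ/2π⌋`, Gaussian floor `e^{-6K²}` on `cube(m)`, `ε_W = e^{-6K²}/4`, tail share `1/4`,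
`c = 1/2`. [cite: LSSY2005, §1.2 (1.17)–(1.19)] -/
theorem windowModeCounting_proof : WindowModeCounting := by
  intro v _hv hWin hTail
  obtain ⟨K, hK, hW⟩ := hWin
  set A : ℝ := 6 * K ^ 2 with hA
  obtain ⟨ρW, hρW, hW1⟩ := hW (Real.exp (-A) / 4) (by positivity)
  obtain ⟨ρT, hρT, hT1⟩ := hTail 1 one_pos (1 / 4) (by norm_num)
  refine ⟨min ρW ρT, lt_min hρW hρT, fun ρ hρ hρ₀ => ⟨1 / 2, by norm_num, ?_⟩⟩
  have hW2 := hW1 ρ hρ (lt_of_lt_of_le hρ₀ (min_le_left _ _))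
  have hT2 := hT1 ρ hρ (lt_of_lt_of_le hρ₀ (min_le_right _ _))
  rw [Filter.eventually_atTop] at hW2
  obtain ⟨a, ha⟩ := hW2
  filter_upwards [hT2, eventually_ge_atTop (a + 1)] with N hTN hNa
  obtain ⟨δT, hδT, hTN⟩ := hTN
  obtain ⟨n, rfl⟩ : ∃ n, N = n + 1 := ⟨N - 1, by omega⟩
  obtain ⟨δW, hδW, hWN⟩ := ha n (by omega)
  -- the geometry of the torus
  set L : ℝ := sideLength ρ (n + 1)
  have hNr : (0 : ℝ) < ((n + 1 : ℕ) : ℝ) := Nat.cast_pos.2 (Nat.succ_pos n)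
  have hL : 0 < L := Real.rpow_pos_of_pos (div_pos hNr hρ) _
  have hsqρ : 0 < Real.sqrt ρ := Real.sqrt_pos.2 hρ
  refine ⟨min δW δT, lt_min hδW hδT, fun Ψ hΨ => ?_⟩
  obtain ⟨R, hKR, hRK, hsum⟩ := hWN Ψ (hΨ.trans (add_le_add le_rfl (min_le_left _ _)))
  have hTΨ := hTN Ψ (hΨ.trans (add_le_add le_rfl (min_le_right _ _)))
  dsimp only at hsum
  have hR0 : 0 < R := pos_of_mul_pos_left (hK.trans_le hKR) hsqρ.le
  set m : ℕ := ⌊L * Real.sqrt ρ / (2 * Real.pi)⌋₊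
  have hcast : ((n + 1 : ℕ) : ℝ) = (n : ℝ) + 1 := by push_cast; ring
  refine condensate_ge_half hL Ψ
    (Finset.Icc (fun _ : Fin 3 => -((m : ℕ) : ℤ)) (fun _ : Fin 3 => ((m : ℕ) : ℤ)))
    (fun k => ENNReal.ofReal (Real.exp (-(R ^ 2 * (2 * Real.pi / L) ^ 2 *
      (∑ l, ((k l : ℤ) : ℝ) ^ 2) / 2)))) (E := ENNReal.ofReal (Real.exp A))
    (T := ENNReal.ofReal (1 / 4 * ((n + 1 : ℕ) : ℝ))) ?_ hsum
    (tsum_ite_mem_cube_le _ fun M => ?_) ?_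
  · -- the Gaussian floor `e^{-A} ≤ e^{-R²p_k²/2}` on `cube(m) ∖ {0}`
    intro k _hk0 hkm
    rw [← ENNReal.ofReal_mul (Real.exp_pos A).le, ← Real.exp_add, ← ENNReal.ofReal_one]
    refine ENNReal.ofReal_le_ofReal (Real.one_le_exp ?_)
    have h1 : ∑ l, ((k l : ℤ) : ℝ) ^ 2 ≤ 3 * (m : ℝ) ^ 2 := sum_sq_le_of_mem_cube hkm
    have h2 : 2 * Real.pi / L * m ≤ Real.sqrt ρ := by
      have h3 : (m : ℝ) ≤ L * Real.sqrt ρ / (2 * Real.pi) := Nat.floor_le (by positivity)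
      rw [le_div_iff₀ (by positivity)] at h3
      rw [div_mul_eq_mul_div, div_le_iff₀ hL]
      linarith
    have h3 : R * (2 * Real.pi / L * m) ≤ 2 * K :=
      le_trans (mul_le_mul_of_nonneg_left h2 hR0.le) hRK
    have h4 : 0 ≤ R * (2 * Real.pi / L * m) := by positivity
    have h5 : R ^ 2 * (2 * Real.pi / L) ^ 2 * (∑ l, ((k l : ℤ) : ℝ) ^ 2) / 2 ≤ A := by
      calc R ^ 2 * (2 * Real.pi / L) ^ 2 * (∑ l, ((k l : ℤ) : ℝ) ^ 2) / 2
          ≤ R ^ 2 * (2 * Real.pi / L) ^ 2 * (3 * (m : ℝ) ^ 2) / 2 := by gcongr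
        _ = 3 / 2 * (R * (2 * Real.pi / L * m)) ^ 2 := by ring
        _ ≤ 3 / 2 * (2 * K) ^ 2 := by gcongr
        _ = A := by rw [hA]; ring
    linarith
  · -- the tail, uniformly in the outer cutoff `M`
    refine hTΨ m M ?_
    rw [one_mul]
    exact (Nat.lt_floor_add_one _).le
  · -- the budget `e^{A}·(e^{-A}/4)(n+1) + (n+1)/4 = (n+1)/2`
    rw [← ENNReal.ofReal_mul (Real.exp_pos A).le, ← ENNReal.ofReal_add (by positivity)
      (by positivity), hcast]
    refine ENNReal.ofReal_le_ofReal (le_of_eq ?_)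
    have hE : Real.exp A * Real.exp (-A) = 1 := by
      rw [← Real.exp_add, add_neg_cancel, Real.exp_zero]
    linear_combination (1 / 4 * ((n : ℝ) + 1)) * hE

end Summit.AtomisticToContinuum.BoseEinsteinCondensation.Theorems
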